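import Summits.CriticalPhenomena.PercolationContinuityZ3.Theorems.PercNearOneGluingNoHeavyLowerTailQ44bPencilReduction
import Literature.Probability.Percolation.FoldingFibres
import HarnessLib

/-!
# `Q44b` for every finite weighted graph from the ANTIPODAL fibre count (the reduction, all `n`)

Support file for crux `stmt-CriticalPhenomena-4575` (master-family programme; quadratic four-point row `Q44b` of
`prim-bnk-1` gen 13, OPEN for all `n`), seat `prim-l12-p1` gen 8; memo
`run/shared/lean/prim/prim-l12/FROM-prim-l12-p1-g8-ANTIPODAL-REDUCTION.md`.

Bond percolation `μ_w = prodBernoulli w` on the pairs of `Fin n`, four vertices `a b c y`, and the row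
`Q44b(w) = P(AC)·P(∅) − P(AΔ)·P(X) − P(ab|c|y)·P(C¬A) − P(a|bcy)·P(X′)` of `…Q44bPencilReduction` (`Q44b.row`;
`AC = {a~b ∧ c~y}`, `∅ = a|b|c|y`, `AΔ = {ab|cy, ab|c|y}`, `X = {ac|by, ay|bc}`, `C¬A = {c~y ∧ a≁b}`,
`X′ = {ac|b|y, ay|b|c}`).

**Folding.**  By the folding identity of the tree (`Literature…FoldingFibres`: van den Berg–Fiebig / Reimer /
Linusson's edge-by-edge conditioning), every product `μ(A)·μ(B)` is a nonnegative combination, over the *fibres*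
`(M, u)` (`M` = the set of pairs where the two copies disagree, `u` = their common open pairs off `M`), of the
COUNTS `#{ω : ω ∖ M = u, ω ∈ A, ω ∆ M ∈ B}` (`Q44b.fibreCount`).  Reading a fibre as the minor "contract `u`, delete
the pairs outside `u ∪ M`" whose free edges `M` are 2-coloured (red `= ω ∩ M`, blue `= M ∖ ω`), the count for the
row is

  `#{red ∈ AC, blue = ∅} − #{(red, blue) of one of the nine bad types}`,

the nine bad types being `(ab|cy | ab|c|y) × (ac|by | ay|bc)`, `ab|c|y × (a|b|cy | acy|b | a|bcy)`,
`a|bcy × (ac|b|y | ay|b|c)` — the programme's fibrewise conjecture **ANTIPODAL** (`prim-bnk-1` gen 15 §2, `prim-l12-p6`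
gen 9 "OTA ⊋ ANTIPODAL"; exhaustive on all monotone maps of `B_≤4`, SAT-certified on `B_5`, 0 violations on every
graph fibre censused), here stated for the graph itself with frozen pairs (`Q44b.Antipodal`).

* `Q44b.row_eq_sum_four` — the row as a signed combination of four products of probabilities;
* `Q44b.row_nonneg_of_antipodal` — **the reduction**: `Q44b.Antipodal n a b c y → ∀ w, 0 ≤ Q44b.row w a b c y`.
  So any proof of the count inequality (GF(2)-rank / rule R7 of `prim-bnk-1` gen 17, Reimer certificates of gen 7,
  oriented Marica–Schönheim of `prim-l12-p6` gen 9) closes `Q44b` for all `n` in the tree by a counting lemma alone;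
* `Q44b.row_nonneg_of_antipodal_fibres` — the same with the hypothesis restricted to the fibres actually used
  (`u` disjoint from `M`), for inductive arguments on minors.

Definitions (`fibreCount`, `Antipodal`) and theorems; no named facts, no sorries, standard axioms.
-/

noncomputable section

namespace Summit.CriticalPhenomena.PercolationContinuityZ3.Theorems

namespace Q44b

open MeasureTheory Set Literature.Probability.LatticeModels Literature.Probability.Percolation
open scoped Classical symmDiff

variable {n : ℕ}

/-! ### Fibre counts and the antipodal hypothesis -/

/-- The fibre count of the pair of events `(A, B)` at the fibre `(M, u)`: the number of configurations `ω`
with `ω ∖ M = u` (so `ω = u ∪ t`, `t ⊆ M`, when `u ∩ M = ∅`), `ω ∈ A` and `ω ∆ M ∈ B` (the antipodal partner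
`u ∪ (M ∖ t)`).  In minor language: 2-colourings of the free edges `M` of the minor `contract u / delete the rest`
with the red subgraph in `A` and the blue subgraph in `B`. [this work] -/
def fibreCount (M u : Set (Sym2 (Fin n))) (A B : Set (BondConfig (Fin n))) : ℕ :=
  (Finset.univ.filter fun ω : Set (Sym2 (Fin n)) => ω \ M = u ∧ ω ∈ A ∧ ω ∆ M ∈ B).card

/-- **Hypothesis ANTIPODAL** (the fibrewise form of `Q44b`; conjectured for every finite graph, `prim-bnk-1` gen 15 /
`prim-l12-p6` gen 9 / `prim-l12-p1` gen 6–7): at every fibre `(M, u)` with `u ∩ M = ∅`, the number of red/blue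
colourings of `M` (red `= u ∪ t`, blue `= u ∪ (M ∖ t)`) with red `∈ AC = {a~b ∧ c~y}` and blue `= a|b|c|y` is at
least the number of colourings of one of the nine bad types:
`#(AΔ, X) + #(ab|c|y, C¬A) + #(a|bcy, X′) ≤ #(AC, ∅)`. [this work] -/
def Antipodal (n : ℕ) (a b c y : Fin n) : Prop :=
  ∀ M u : Set (Sym2 (Fin n)), Disjoint u M →
    fibreCount M u (evAD a b c y) (evX a b c y) + fibreCount M u (evAB a b c y) (evCnA a b c y) +
        fibreCount M u (evPend a b c y) (evXp a b c y) ≤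
      fibreCount M u (evAC a b c y) (evEmp a b c y)

/-! ### The reduction -/

/-- `Q44b(w)` as the signed combination `Σ_{i<4} c_i · μ_w(A_i) · μ_w(B_i)` with `c = (1,−1,−1,−1)`,
`A = (AC, AΔ, ab|c|y, a|bcy)`, `B = (∅, X, C¬A, X′)` (the shape consumed by the folding lemma). [this work] -/
theorem row_eq_sum_four (w : Sym2 (Fin n) → unitInterval) (a b c y : Fin n) :
    row w a b c y = ∑ i : Fin 4, (![1, -1, -1, -1] : Fin 4 → ℝ) i *
      ((prodBernoulli w).real ((![evAC a b c y, evAD a b c y, evAB a b c y, evPend a b c y] :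
          Fin 4 → Set (BondConfig (Fin n))) i) *
        (prodBernoulli w).real ((![evEmp a b c y, evX a b c y, evCnA a b c y, evXp a b c y] :
          Fin 4 → Set (BondConfig (Fin n))) i)) := by
  rw [Fin.sum_univ_four]
  simp only [Matrix.cons_val_zero, Matrix.cons_val_one, Matrix.cons_val]
  unfold row bil
  ring

/-- **`Q44b` from the antipodal count, fibre by fibre.**  If at every fibre `(M, u)` with `u ∩ M = ∅` the bad
colourings are at most the good ones, then `0 ≤ Q44b(w)` for EVERY weighting `w` (folding identity
`Literature…FoldingFibres.prodBernoulli_sum_mul_nonneg_of_fibrewise`). [this work] -/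
theorem row_nonneg_of_antipodal_fibres (a b c y : Fin n)
    (h : ∀ M u : Set (Sym2 (Fin n)), Disjoint u M →
      fibreCount M u (evAD a b c y) (evX a b c y) + fibreCount M u (evAB a b c y) (evCnA a b c y) +
          fibreCount M u (evPend a b c y) (evXp a b c y) ≤
        fibreCount M u (evAC a b c y) (evEmp a b c y))
    (w : Sym2 (Fin n) → unitInterval) : 0 ≤ row w a b c y := by
  rw [row_eq_sum_four]
  refine prodBernoulli_sum_mul_nonneg_of_fibrewise Finset.univ _ w _ _ fun M u hd => ?_
  have hMu := h M u hd
  unfold fibreCount at hMu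
  rw [Fin.sum_univ_four]
  simp only [Matrix.cons_val_zero, Matrix.cons_val_one, Matrix.cons_val]
  have hcast : ((Finset.univ.filter fun ω : Set (Sym2 (Fin n)) =>
        ω \ M = u ∧ ω ∈ evAD a b c y ∧ ω ∆ M ∈ evX a b c y).card : ℝ) +
      ((Finset.univ.filter fun ω : Set (Sym2 (Fin n)) =>
        ω \ M = u ∧ ω ∈ evAB a b c y ∧ ω ∆ M ∈ evCnA a b c y).card : ℝ) +
      ((Finset.univ.filter fun ω : Set (Sym2 (Fin n)) =>
        ω \ M = u ∧ ω ∈ evPend a b c y ∧ ω ∆ M ∈ evXp a b c y).card : ℝ) ≤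
      ((Finset.univ.filter fun ω : Set (Sym2 (Fin n)) =>
        ω \ M = u ∧ ω ∈ evAC a b c y ∧ ω ∆ M ∈ evEmp a b c y).card : ℝ) := by
    exact_mod_cast hMu
  linarith

/-- **THE REDUCTION**: `ANTIPODAL ⇒ Q44b` for every finite weighted graph on `Fin n`. [this work] -/
theorem row_nonneg_of_antipodal {a b c y : Fin n} (h : Antipodal n a b c y)
    (w : Sym2 (Fin n) → unitInterval) : 0 ≤ row w a b c y :=
  row_nonneg_of_antipodal_fibres a b c y h w

end Q44b

end Summit.CriticalPhenomena.PercolationContinuityZ3.Theorems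

end
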